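import Mathlib
import Summits.ResolutionOfSingularities.ResolutionOfSingularities.Theorems.RadicialJungCleanModelsBranchDescent
import Literature.AlgebraicGeometry.Resolution.OrderGenerizationCoheightOne
import HarnessLib

/-!
# Route `RadicialJung`, crux `CleanModels` (stmt-ResolutionOfSingularities-15917), line `Sketch` rev 35, stub 6 `stub_cleanProp44` (X44c),
# `τ = 1` residual, (B5″) branch descent: THE DIMENSION-ONE FORM

Seat decomp-res-hand-2 g14 (structural hand).  Companion of ✓ `…BranchDescent.lean` (`exists_add_mul_pow_mem_under_of_mem_minimalPrimes`: `p`-th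
powers descend from a formal prime `𝔓 ⊂ R^` MINIMAL over `𝔮 R^`, `𝔮 = 𝔓 ∩ R`, to `κ(𝔮)`).  Here the minimality hypothesis is discharged in the
form in which a formal BRANCH OF A CURVE presents itself: `dim R/𝔮 ≤ 1` and `𝔓 ≠ 𝔪̂` (then `R^/𝔮R^`, of dimension `dim R/𝔮 ≤ 1` by
✓ `ringKrullDim_adicCompletion_quotient_map` — Matsumura 8.11 + 15.1 — has no room for a prime strictly between a minimal prime of `𝔮 R^` and
`𝔓 ⊊ 𝔪̂`).

* `mem_minimalPrimes_of_ringKrullDim_quotient_le_one` — `R` Noetherian local, `𝔓 ≠ 𝔪̂` a prime of `R^` with `dim R/(𝔓 ∩ R) ≤ 1`: `𝔓` is minimal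
  over `(𝔓 ∩ R) R^`.
* `exists_add_mul_pow_mem_under_of_ringKrullDim_le_one` — the brick in this currency: `R` a local G-ring of characteristic `p`, `𝔓 ≠ 𝔪̂` with
  `dim R/(𝔓 ∩ R) ≤ 1`, `t + w ĝ^p ∈ 𝔓` ⟹ `t b^p + w a^p ∈ 𝔓 ∩ R` for some `a, b ∈ R`, `b ∉ 𝔓 ∩ R`.

Honest framing: OURS, folklore; nothing here proves (B5″)'s dictionary, X44c, any case of `CleanModels`, or resolution of singularities in
characteristic `p`. [cite: Matsumura1987, Thm. 8.11; §15 Thm. 15.1; §32 p. 256]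
-/

set_option linter.dupNamespace false -- mandated namespace of this single-conjunct summit

noncomputable section

open IsLocalRing
open Literature.AlgebraicGeometry.Resolution

namespace Summit.ResolutionOfSingularities.ResolutionOfSingularities.Theorems.RadicialJung.CleanModels

universe u

section Dim

variable {R : Type u} [CommRing R] [IsLocalRing R]

/-- Images of comparable ideals containing the kernel stay distinct. [folklore] -/
theorem map_quotient_mk_lt_of_lt {S : Type u} [CommRing S] (I : Ideal S) {Q P : Ideal S} (hIQ : I ≤ Q) (hlt : Q < P) :
    Q.map (Ideal.Quotient.mk I) < P.map (Ideal.Quotient.mk I) := by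
  refine lt_of_le_of_ne (Ideal.map_mono hlt.le) fun h => hlt.ne ?_
  have h1 := congrArg (Ideal.comap (Ideal.Quotient.mk I)) h
  simp only [Ideal.comap_map_of_surjective _ Ideal.Quotient.mk_surjective, ← RingHom.ker_eq_comap_bot, Ideal.mk_ker,
    sup_eq_left.mpr hIQ, sup_eq_left.mpr (hIQ.trans hlt.le)] at h1
  exact h1

/-- **A non-maximal formal prime over a curve is a minimal prime of the extended ideal.**  `R` Noetherian local, `𝔓` a prime of `R^` with
`𝔓 ≠ 𝔪̂` and `dim R/𝔮 ≤ 1`, `𝔮 = 𝔓 ∩ R`: `𝔓` is a minimal prime over `𝔮 R^` (a chain `Q ⊊ 𝔓 ⊊ 𝔪̂` over `𝔮 R^` would give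
`dim R^/𝔮R^ ≥ 2`, but `dim R^/𝔮R^ = dim R/𝔮`). [cite: Matsumura1987, Thm. 8.11; §15 Thm. 15.1] -/
theorem mem_minimalPrimes_of_ringKrullDim_quotient_le_one [IsNoetherianRing R]
    (𝔓 : Ideal (AdicCompletion (maximalIdeal R) R)) [𝔓.IsPrime] (hne : 𝔓 ≠ maximalIdeal (AdicCompletion (maximalIdeal R) R))
    (hdim : ringKrullDim (R ⧸ 𝔓.under R) ≤ 1) :
    𝔓 ∈ ((𝔓.under R).map (algebraMap R (AdicCompletion (maximalIdeal R) R))).minimalPrimes := by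
  haveI : IsNoetherianRing (AdicCompletion (maximalIdeal R) R) := isNoetherianRing_adicCompletion_maximalIdeal R
  have hIP : (𝔓.under R).map (algebraMap R (AdicCompletion (maximalIdeal R) R)) ≤ 𝔓 := Ideal.map_comap_le
  obtain ⟨Q, hQmin, hQP⟩ := Ideal.exists_minimalPrimes_le hIP
  haveI hQ : Q.IsPrime := hQmin.1.1
  by_cases hQe : Q = 𝔓
  · rwa [hQe] at hQmin
  exfalso
  have hIQ : (𝔓.under R).map (algebraMap R (AdicCompletion (maximalIdeal R) R)) ≤ Q := hQmin.1.2
  have hQlt : Q < 𝔓 := lt_of_le_of_ne hQP hQe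
  have hPlt : 𝔓 < maximalIdeal (AdicCompletion (maximalIdeal R) R) :=
    lt_of_le_of_ne (IsLocalRing.le_maximalIdeal Ideal.IsPrime.ne_top') hne
  -- in `R^ ⧸ 𝔮 R^`, of dimension `dim R/𝔮 ≤ 1`, the images form a chain of length `2`
  have hdimI : ringKrullDim (AdicCompletion (maximalIdeal R) R ⧸
      (𝔓.under R).map (algebraMap R (AdicCompletion (maximalIdeal R) R))) ≤ 1 := by
    rw [ringKrullDim_adicCompletion_quotient_map]; exact hdim
  haveI h1 : (Q.map (Ideal.Quotient.mk ((𝔓.under R).map (algebraMap R (AdicCompletion (maximalIdeal R) R))))).IsPrime :=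
    Ideal.map_isPrime_of_surjective Ideal.Quotient.mk_surjective (by rwa [Ideal.mk_ker])
  haveI h2 : (𝔓.map (Ideal.Quotient.mk ((𝔓.under R).map (algebraMap R (AdicCompletion (maximalIdeal R) R))))).IsPrime :=
    Ideal.map_isPrime_of_surjective Ideal.Quotient.mk_surjective (by rwa [Ideal.mk_ker])
  haveI h3 : ((maximalIdeal (AdicCompletion (maximalIdeal R) R)).map
      (Ideal.Quotient.mk ((𝔓.under R).map (algebraMap R (AdicCompletion (maximalIdeal R) R))))).IsPrime :=
    Ideal.map_isPrime_of_surjective Ideal.Quotient.mk_surjective (by rw [Ideal.mk_ker]; exact hIP.trans hPlt.le)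
  have hlt1 := map_quotient_mk_lt_of_lt _ hIQ hQlt
  have hlt2 := map_quotient_mk_lt_of_lt _ hIP hPlt
  have ha := Ideal.height_add_one_le_of_lt_of_isPrime hlt1
  have hb := Ideal.height_add_one_le_of_lt_of_isPrime hlt2
  have hc : ((((maximalIdeal (AdicCompletion (maximalIdeal R) R)).map
      (Ideal.Quotient.mk ((𝔓.under R).map (algebraMap R (AdicCompletion (maximalIdeal R) R))))).height : ℕ∞) : WithBot ℕ∞) ≤ 1 :=
    le_trans Ideal.height_le_ringKrullDim_of_isPrime hdimI
  have hc' : ((maximalIdeal (AdicCompletion (maximalIdeal R) R)).map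
      (Ideal.Quotient.mk ((𝔓.under R).map (algebraMap R (AdicCompletion (maximalIdeal R) R))))).height ≤ 1 := by
    exact_mod_cast hc
  have h2le : (2 : ℕ∞) ≤ ((maximalIdeal (AdicCompletion (maximalIdeal R) R)).map
      (Ideal.Quotient.mk ((𝔓.under R).map (algebraMap R (AdicCompletion (maximalIdeal R) R))))).height := by
    have h1le : (1 : ℕ∞) ≤ (𝔓.map (Ideal.Quotient.mk ((𝔓.under R).map (algebraMap R (AdicCompletion (maximalIdeal R) R))))).height :=
      le_trans le_add_self ha
    calc (2 : ℕ∞) = 1 + 1 := by norm_num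
      _ ≤ _ := le_trans (add_le_add h1le le_rfl) hb
  have h21 : (2 : ℕ∞) ≤ 1 := le_trans h2le hc'
  exact absurd h21 (by norm_num)

/-- **Branch descent of `p`-th powers, dimension-one form.**  `R` a local G-ring of characteristic `p`, `𝔓` a prime of `R^` with `𝔓 ≠ 𝔪̂` and
`dim R/(𝔓 ∩ R) ≤ 1` (a formal branch of the curve `𝔮 = 𝔓 ∩ R`), `t, w ∈ R`, `ĝ ∈ R^` with `t + w ĝ^p ∈ 𝔓`: there are `a, b ∈ R`, `b ∉ 𝔮`,
with `t b^p + w a^p ∈ 𝔮`. [cite: Matsumura1987, §32 p. 256] -/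
theorem exists_add_mul_pow_mem_under_of_ringKrullDim_le_one [IsNoetherianRing R] (hG : IsGRing R) (p : ℕ) [Fact p.Prime] [CharP R p]
    (𝔓 : Ideal (AdicCompletion (maximalIdeal R) R)) [𝔓.IsPrime] (hne : 𝔓 ≠ maximalIdeal (AdicCompletion (maximalIdeal R) R))
    (hdim : ringKrullDim (R ⧸ 𝔓.under R) ≤ 1) {t w : R} {ĝ : AdicCompletion (maximalIdeal R) R}
    (h : algebraMap R _ t + algebraMap R _ w * ĝ ^ p ∈ 𝔓) :
    ∃ a b : R, b ∉ 𝔓.under R ∧ t * b ^ p + w * a ^ p ∈ 𝔓.under R := by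
  exact exists_add_mul_pow_mem_under_of_mem_minimalPrimes hG p 𝔓
    (mem_minimalPrimes_of_ringKrullDim_quotient_le_one 𝔓 hne hdim) h

end Dim

end Summit.ResolutionOfSingularities.ResolutionOfSingularities.Theorems.RadicialJung.CleanModels

end
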